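import Summits.ABC.ABC.Theses.IneffectiveSubspace
import Literature.NumberTheory.DiophantineGeometry.AbcDepthCensusTurboSym
import Summits.ABC.ABC.Theorems.IneffectiveSubspaceDeepRegimeABCCensusCellTen20A
import Summits.ABC.ABC.Theorems.IneffectiveSubspaceDeepRegimeABCCensusCellTen20B
import Summits.ABC.ABC.Theorems.IneffectiveSubspaceDeepRegimeABCCensusCellEightD
import Summits.ABC.ABC.Theorems.IneffectiveSubspaceDeepRegimeABCCensusCellNine18E

/-!
# `DeepRegimeABC` (stmt-ABC-15121): certified census — the cell `ω₅ ≥ 10` does not meet `c ≤ 10²⁰` (C, assembly)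

Compute-certificate (line lead `prover-line-stmt-ABC-15121-c3-0`, 2026-08-16; human certificate
objective) for the crux `Summit.ABC.ABC.Theses.IneffectiveSubspace.DeepRegimeABC` (abc with exponent
`1 + ε` on the deep tail `{ω₅(abc) ≥ K(ε)}`, `ω₅(n) := #{p : p⁵ ∣ n}`), with the symmetric turbo checker
`Literature.NumberTheory.DiophantineGeometry.DepthCensus.checkTurboChunkSym` (`AbcDepthCensusTurboSym.lean`:
min-member cut, fused threshold-table walk, run-time-validated CRT unit, patterns with `A ≤ B` only;
`depth_lt_of_checkTurboChunksSym`).  Sharpens `…CensusDeepTailOddB.lean` (lead c2-0: the cell `ω₅ ≥ 10`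
does not meet `c ≤ 10¹⁹`) by one decade.

**The certificate these runs serve** (assembled in `…CensusCellTen20C.lean`, registered stub
`censusCellTen20`): **the cell `{ω₅ ≥ 10}` contains no abc triple with `c ≤ 10²⁰`** — not even a lattice
candidate of any depth pattern of ten primes (`10001⁵ > 10²⁰`).  The box has `40 402 494` depth patterns
(`9.7·10⁷` tree nodes after the min-member cut, `1.9·10⁸` outer steps); the cover is the 13-chunk cover `S₁₃`
of depth 2 (`coversAll_S8`), over three files: A = `[0]`, `[1,0]`, `[2,0]`, `[3,0]`, `[1,1]`, `[1,2]`, `[1,3]`;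
B = `[2,1]`, `[2,2]`, `[2,3]`, `[3,1]`; C = `[3,2]`, `[3,3]` + assembly (big chunks `4.4–4.5·10⁶` patterns,
≈ 70 s of farm time each with the symmetric turbo checker).

**Certified here** (file C): the last two chunks, the assembly over `S₁₃` (`t10chunks_all`), and the
conclusion: `depth_le_nine_of_le_tenPow20` (**`ω₅(abc) ≤ 9` for every abc triple with `c ≤ 10²⁰`**),
`tenPow20_lt_of_ten_le_depth` (the cell `ω₅ ≥ 10` lies in `{c > 10²⁰}`), and with `…CensusCellNine18E.lean`
the even decades `c > 10^(2K)` for `K = 8, 9, 10` (`tenPow_two_mul_lt_of_le_depth'`).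
-/

-- `Summit.<Summit>.<Problem>` is the mandated summit-side namespace (CONVENTIONS §2); for the
-- single-conjunct summit `ABC` the two coincide, so the duplicate `ABC.ABC` is deliberate.
set_option linter.dupNamespace false

namespace Summit.ABC.ABC.Theorems.DeepRegimeABC

open Literature.NumberTheory.DiophantineGeometry
open Literature.NumberTheory.DiophantineGeometry.DepthCensus

/-! ## The compiled chunk runs of this file -/

/-- Chunk `[3, 2]` of the cell `ω₅ ≥ 10` in the box `c ≤ 10²⁰` (4 372 838 patterns, 20 714 674 outer steps): no lattice
candidate. [folklore] -/
theorem t10chunk_32 :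
    checkTurboChunkSym (10 ^ 20) 10000 10 [3, 2] (fun _ _ _ => false) = true := by
  native_decide

/-- Chunk `[3, 3]` of the cell `ω₅ ≥ 10` in the box `c ≤ 10²⁰` (4 507 126 patterns, 20 592 697 outer steps): no lattice
candidate. [folklore] -/
theorem t10chunk_33 :
    checkTurboChunkSym (10 ^ 20) 10000 10 [3, 3] (fun _ _ _ => false) = true := by
  native_decide

/-! ## The assembled run over the cover `S₁₃` -/

/-- Every chunk of `S₁₃` accepts the always-failing test (the thirteen runs of files A–C): the cell `ω₅ ≥ 10`
has no lattice candidate in the box `c ≤ 10²⁰`. [folklore] -/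
theorem t10chunks_all : ∀ s ∈ ([[0], [1, 0], [1, 1], [1, 2], [1, 3], [2, 0], [2, 1], [2, 2], [2, 3], [3, 0], [3, 1], [3, 2], [3, 3]] : List (List (Fin 4))),
    checkTurboChunkSym (10 ^ 20) 10000 10 s (fun _ _ _ => false) = true := by
  intro s hs
  simp only [List.mem_cons, List.mem_nil_iff, or_false] at hs
  rcases hs with rfl | rfl | rfl | rfl | rfl | rfl | rfl | rfl | rfl | rfl | rfl | rfl | rfl
  exacts [t10chunk_0, t10chunk_10, t10chunk_11, t10chunk_12, t10chunk_13, t10chunk_20, t10chunk_21, t10chunk_22, t10chunk_23, t10chunk_30, t10chunk_31, t10chunk_32, t10chunk_33]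

/-! ## No abc triple of depth `≥ 10` with `c ≤ 10²⁰` -/

/-- **`ω₅(abc) ≤ 9` for every abc triple with `c ≤ 10²⁰`** (`10001⁵ > 10²⁰`). [folklore] -/
theorem depth_le_nine_of_le_tenPow20 {a b c : ℕ} (habc : IsABCTriple a b c) (hc : c ≤ 10 ^ 20) :
    ((a * b * c).primeFactors.filter (fun p => 5 ≤ (a * b * c).factorization p)).card ≤ 9 :=
  Nat.le_of_lt_succ (depth_lt_of_checkTurboChunksSym (by norm_num) coversAll_S8 t10chunks_all habc hc)

/-- **The cell `ω₅ ≥ 10` lies in `{c > 10²⁰}`.** [folklore] -/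
theorem tenPow20_lt_of_ten_le_depth {a b c : ℕ} (habc : IsABCTriple a b c)
    (hK : 10 ≤ ((a * b * c).primeFactors.filter (fun p => 5 ≤ (a * b * c).factorization p)).card) :
    10 ^ 20 < c := by
  by_contra h
  exact absurd (hK.trans (depth_le_nine_of_le_tenPow20 habc (not_lt.mp h))) (by norm_num)

/-- The even decades for `K = 8, 9, 10`: **`ω₅(abc) ≥ K ⟹ c > 10^(2K)`** (`…CensusCellEightD.lean`,
`…CensusCellNine18E.lean`, this file). [folklore] -/
theorem tenPow_two_mul_lt_of_le_depth' {a b c K : ℕ} (habc : IsABCTriple a b c) (h8 : 8 ≤ K) (h10 : K ≤ 10)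
    (hK : K ≤ ((a * b * c).primeFactors.filter (fun p => 5 ≤ (a * b * c).factorization p)).card) :
    10 ^ (2 * K) < c := by
  rcases Nat.lt_or_ge K 10 with h | h
  · exact tenPow_two_mul_lt_of_le_depth habc h8 (by omega) hK
  · have hK10 : K = 10 := le_antisymm h10 h
    subst hK10
    exact tenPow20_lt_of_ten_le_depth habc hK

/-! ## Registered certificate stub of the crux item (stmt-ABC-15121) -/

/-- **Registered certificate `censusCellTen20`** (crux `DeepRegimeABC`, line SketchIdeator5R2, human
certificate objective): the deep cell `{ω₅ ≥ 10}` contains no abc triple with `c ≤ 10²⁰`. [folklore] -/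
theorem censusCellTen20 : (∀ a b c : ℕ, Literature.NumberTheory.DiophantineGeometry.IsABCTriple a b c → c ≤ 10 ^ 20 → ((a * b * c).primeFactors.filter (fun p => 5 ≤ (a * b * c).factorization p)).card ≤ 9) ∧ (∀ a b c : ℕ, Literature.NumberTheory.DiophantineGeometry.IsABCTriple a b c → 10 ≤ ((a * b * c).primeFactors.filter (fun p => 5 ≤ (a * b * c).factorization p)).card → 10 ^ 20 < c) :=
  ⟨fun _ _ _ h hc => depth_le_nine_of_le_tenPow20 h hc, fun _ _ _ h hK => tenPow20_lt_of_ten_le_depth h hK⟩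

end Summit.ABC.ABC.Theorems.DeepRegimeABC
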